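import Mathlib
import Summits.AtomisticToContinuum.HydrodynamicLimit.Theorems.InformationPercolationEngineKickFairRelEquilibriumMesoLongWindowDefs
import Literature.MathematicalPhysics.KineticTheory.CollisionWindowBookkeeping
import Literature.MathematicalPhysics.KineticTheory.CollisionTubePullbackFlight
import HarnessLib

/-!
# `KickFairRelEquilibriumMeso`, line `kinetic-window-cut` (rev 5) — kick geometry of the long-flight window cut

Prover file (`--supports stmt-AtomisticToContinuum-15177`, wave 1 of rev 5, lead c8) for the five kick-geometry stubs
of the close-pair count CPL of the line `Cruxes/KickFairRelEquilibriumMeso/Lines/kinetic_window_cut.lean` (rev 5, the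
LONG-FLIGHT window cut) of the crux `…Theses.InformationPercolationEngine.KickFairRelEquilibriumMeso`: the dynamic-geometric
inputs of the deterministic count of close same-window pairs of long-flight kicks.

* Grid arithmetic of the common grid times (`gridMesh A tw = tw/(2A) = m`, `gridIdx A tw t = ⌈t/m⌉ − 1`,
  `gridTime = m · gridIdx`): the grid time preceding `t` lies in `[t − m, t)` (`gridTime_mem`); two times `≥ tw/A = 2m`
  apart have grid indices differing by `≥ 2` (`gridIdx_add_two_le`); the grid index of a time in the kinetic window
  `[v·tw, (v+1)·tw)`, `v = ⌊t/tw⌋`, lies in `[2Av − 1, 2A(v+1))` (`gridIdx_window_bounds`).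
* Free flight read off the typed past, on the good set: sphere `i` flies freely on `(s_i, t]`, `s_i` the start of the
  flight ending in its `n`-th collision at time `t = t_{i,n} ≥ 0` (`not_participates_of_mem_Ioo_flightStart`,
  `orbit_pos_eq_of_forall_not_participates`), the first photo of the typed past records the `r`-cell of `x_i(s_i)` and
  the exact velocity `v_i(s_i)`, and a point is within `r` of the centre of its `r`-cell; by translation invariance of
  the minimal-image distance the true collision point `x_i(t) = x_i(s_i) + proj((t − s_i) v_i)` is within `r` of the
  predicted collision point `predPt` (`euclidDist_collPt_predPt_le`), and, for a LONG kick (`t − s_i ≥ t_N/A = 2m`), the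
  grid time `u = gridTime A t_N t ∈ [t − m, t) ⊆ (s_i, t)` sees sphere `i` within `r` of its anchor `anchorPt` with
  velocity exactly the photo velocity (`flow_gridTime_anchorPt`).
-/

noncomputable section

open MeasureTheory Set Filter Topology
open scoped ENNReal Classical

namespace Summit.AtomisticToContinuum.HydrodynamicLimit.Theorems.KickFairRelEquilibriumMesoLine

open Literature.Analysis.FluidPDE Literature.MathematicalPhysics.KineticTheory

/-! ## Grid arithmetic -/

/-- The grid mesh `m = tw/(2A)` is positive. [folklore] -/
theorem gridMesh_pos {A tw : ℝ} (hA : 0 < A) (htw : 0 < tw) : 0 < gridMesh A tw := by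
  unfold gridMesh
  positivity

/-- `tw / A = 2m`. [folklore] -/
theorem div_eq_two_mul_gridMesh {A : ℝ} (hA : 0 < A) (tw : ℝ) : tw / A = 2 * gridMesh A tw := by
  unfold gridMesh
  field_simp

/-- `t / m = 2A · (t / tw)`. [folklore] -/
theorem div_gridMesh_eq {A tw : ℝ} (hA : 0 < A) (htw : 0 < tw) (t : ℝ) :
    t / gridMesh A tw = 2 * A * (t / tw) := by
  unfold gridMesh
  field_simp

/-- **The grid time preceding `t` lies in `[t − m, t)`**: `m(⌈t/m⌉ − 1) ∈ [t − m, t)` since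
`⌈x⌉ − 1 < x ≤ ⌈x⌉`. [folklore] -/
theorem gridTime_mem : ∀ (A tw t : ℝ), 0 < A → 0 < tw → gridTime A tw t ∈ Set.Ico (t - gridMesh A tw) t := by
  intro A tw t hA htw
  have hm : 0 < gridMesh A tw := gridMesh_pos hA htw
  have h1 : t / gridMesh A tw ≤ (⌈t / gridMesh A tw⌉ : ℝ) := Int.le_ceil _
  have h2 : (⌈t / gridMesh A tw⌉ : ℝ) < t / gridMesh A tw + 1 := Int.ceil_lt_add_one _
  have ht : gridMesh A tw * (t / gridMesh A tw) = t := mul_div_cancel₀ t hm.ne'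
  unfold gridTime gridIdx
  push_cast
  constructor
  · nlinarith
  · nlinarith

/-- **Two times at least `tw/A = 2m` apart have grid indices differing by at least `2`**
(`⌈x + 2⌉ = ⌈x⌉ + 2` and monotonicity of `⌈·⌉`). [folklore] -/
theorem gridIdx_add_two_le : ∀ (A tw t t' : ℝ), 0 < A → 0 < tw → tw / A ≤ t' - t →
    gridIdx A tw t + 2 ≤ gridIdx A tw t' := by
  intro A tw t t' hA htw h
  have hm : 0 < gridMesh A tw := gridMesh_pos hA htw
  rw [div_eq_two_mul_gridMesh hA] at h
  have hdiv : t / gridMesh A tw + 2 ≤ t' / gridMesh A tw := by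
    rw [div_add' _ _ _ hm.ne', div_le_div_iff_of_pos_right hm]
    linarith
  have hc := Int.ceil_le_ceil hdiv
  rw [Int.ceil_add_ofNat] at hc
  unfold gridIdx
  omega

/-- **The grid index of a time in the kinetic window `[v·tw, (v+1)·tw)`, `v = ⌊t/tw⌋`, lies in `[2Av − 1, 2A(v+1))`**
(`t/m = 2A·(t/tw)`, `v ≤ t/tw < v + 1`, `⌈x⌉ − 1 < x ≤ ⌈x⌉`). [folklore] -/
theorem gridIdx_window_bounds : ∀ (A tw t : ℝ), 0 < A → 0 < tw →
    2 * A * (⌊t / tw⌋ : ℝ) - 1 ≤ (gridIdx A tw t : ℝ) ∧ (gridIdx A tw t : ℝ) < 2 * A * ((⌊t / tw⌋ : ℝ) + 1) := by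
  intro A tw t hA htw
  have hv1 : (⌊t / tw⌋ : ℝ) ≤ t / tw := Int.floor_le _
  have hv2 : t / tw < (⌊t / tw⌋ : ℝ) + 1 := Int.lt_floor_add_one _
  have hA2 : (0 : ℝ) < 2 * A := by positivity
  have hl : 2 * A * (⌊t / tw⌋ : ℝ) ≤ 2 * A * (t / tw) := mul_le_mul_of_nonneg_left hv1 hA2.le
  have hu : 2 * A * (t / tw) < 2 * A * ((⌊t / tw⌋ : ℝ) + 1) := mul_lt_mul_of_pos_left hv2 hA2
  unfold gridIdx
  rw [div_gridMesh_eq hA htw]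
  have hc1 : 2 * A * (t / tw) ≤ (⌈2 * A * (t / tw)⌉ : ℝ) := Int.le_ceil _
  have hc2 : (⌈2 * A * (t / tw)⌉ : ℝ) < 2 * A * (t / tw) + 1 := Int.ceil_lt_add_one _
  push_cast
  constructor
  · linarith
  · linarith

/-! ## Free flight from the flight start, along a good orbit -/

section Flight

variable {σ : ℝ} {N : ℕ}

/-- Translation invariance of the minimal-image distance: `d(x + p, y + p) = d(x, y)`. [folklore] -/
theorem torus_euclidDist_add_right (x y p : T3) : Torus.euclidDist (x + p) (y + p) = Torus.euclidDist x y := by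
  rw [Torus.euclidDist_eq, Torus.euclidDist_eq, add_sub_add_right_eq_sub]

/-- The start of the flight of `i` ending at a time `t ≥ 0` (history from time `0`) is at most `t`. [folklore] -/
theorem flightStart_le_self {Φ : Flow σ N} {z : Phase N} (hz : z ∈ Φ.good) (i : Fin (N + 1)) {t : ℝ} (ht : 0 ≤ t) :
    flightStart (Torus.geometry (Fin 3)) (hsDiameter σ N) (fun s => Φ.flow s z) 0 i t ≤ t := by
  rcases mem_insert_iff.1 ((Φ.isTrajectory z hz).flightStart_mem 0 i t) with h | h
  · rw [h]
    exact ht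
  · exact h.2.2.le

/-- **Free flight of `i` from its flight start (positions).** On the good set, for `t ≥ 0` and
`u ∈ [s_i, t]`, `s_i = flightStart … 0 i t`: `x_i(u) = x_i(s_i) + proj((u − s_i) v_i(s_i))` (no collision of `i` in
`(s_i, t)`; positions are continuous). [folklore] -/
theorem flow_pos_eq_of_mem_Icc_flightStart {Φ : Flow σ N} {z : Phase N} (hz : z ∈ Φ.good) (i : Fin (N + 1))
    {t u : ℝ} (ht : 0 ≤ t)
    (hu : u ∈ Icc (flightStart (Torus.geometry (Fin 3)) (hsDiameter σ N) (fun s => Φ.flow s z) 0 i t) t) :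
    ((Φ.flow u z) i).1 =
      ((Φ.flow (flightStart (Torus.geometry (Fin 3)) (hsDiameter σ N) (fun s => Φ.flow s z) 0 i t) z) i).1 +
        Literature.Analysis.FunctionSpaces.Torus.proj
          ((u - flightStart (Torus.geometry (Fin 3)) (hsDiameter σ N) (fun s => Φ.flow s z) 0 i t) •
            ((Φ.flow (flightStart (Torus.geometry (Fin 3)) (hsDiameter σ N) (fun s => Φ.flow s z) 0 i t) z) i).2) := by
  have hfree : ∀ v ∈ Ioo (flightStart (Torus.geometry (Fin 3)) (hsDiameter σ N) (fun s => Φ.flow s z) 0 i t) t,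
      ¬ Participates (Torus.geometry (Fin 3)) (hsDiameter σ N) (orbit σ N Φ z v) i := fun v hv =>
    (Φ.isTrajectory z hz).not_participates_of_mem_Ioo_flightStart hv
  exact orbit_pos_eq_of_forall_not_participates hz i (flightStart_le_self hz i ht) hfree hu

/-- **Free flight of `i` from its flight start (velocities).** On the good set, for `u ∈ [s_i, t)`: `v_i(u) = v_i(s_i)`.
[folklore] -/
theorem flow_vel_eq_of_mem_Ico_flightStart {Φ : Flow σ N} {z : Phase N} (hz : z ∈ Φ.good) (i : Fin (N + 1))
    {t u : ℝ}
    (hu : u ∈ Ico (flightStart (Torus.geometry (Fin 3)) (hsDiameter σ N) (fun s => Φ.flow s z) 0 i t) t) :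
    ((Φ.flow u z) i).2 =
      ((Φ.flow (flightStart (Torus.geometry (Fin 3)) (hsDiameter σ N) (fun s => Φ.flow s z) 0 i t) z) i).2 := by
  have hfree : ∀ v ∈ Ioo (flightStart (Torus.geometry (Fin 3)) (hsDiameter σ N) (fun s => Φ.flow s z) 0 i t) t,
      ¬ Participates (Torus.geometry (Fin 3)) (hsDiameter σ N) (orbit σ N Φ z v) i := fun v hv =>
    (Φ.isTrajectory z hz).not_participates_of_mem_Ioo_flightStart hv
  exact orbit_vel_eq_of_forall_not_participates hz i hfree hu

end Flight

/-! ## The registered stubs: the collision point is near `predPt`, the grid-time position near `anchorPt` -/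

/-- **THE TRUE COLLISION POINT IS WITHIN `r` OF THE PREDICTED ONE.** On the good set, for `t = t_{i,n} ≥ 0`: sphere `i`
flies freely on `[s_i, t]` with the photo velocity `v_i`, so `x_i(t) = x_i(s_i) + proj((t − s_i) v_i)`, while
`predPt = centre(cell of x_i(s_i)) + proj((t − s_i) v_i)`; the centre of the `r`-cell of a point is within `r` of it, and
the minimal-image distance is translation invariant. [folklore] -/
theorem euclidDist_collPt_predPt_le : ∀ (σ : ℝ) (N : ℕ) (Φ : Flow σ N) (r : ℝ), 0 < σ → 0 < r →
    ∀ z : Phase N, z ∈ Φ.good → ∀ (i : Fin (N + 1)) (n : ℕ), 0 ≤ Φ.nthCollisionTimeOf i n z →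
    Torus.euclidDist ((Φ.flow (Φ.nthCollisionTimeOf i n z) z) i).1 (predPt r (past Φ r z i n) i) ≤ r := by
  intro σ N Φ r _ hr z hz i n ht
  simp only [predPt, past, if_pos hz, HardSphereFlow.coarsePastOf, coarseConfig_apply]
  rw [flow_pos_eq_of_mem_Icc_flightStart hz i ht ⟨flightStart_le_self hz i ht, le_rfl⟩, torus_euclidDist_add_right]
  exact euclidDist_cellCentre_coarseCell_le hr _

/-- **AT THE GRID TIME A LONG KICK'S SPHERE IS WITHIN `r` OF ITS ANCHOR, WITH THE PHOTO VELOCITY.** On the good set, for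
a long kick (`t − s_i ≥ t_N/A = 2m`, `t = t_{i,n} ≥ 0`) the grid time `u = gridTime A t_N t ∈ [t − m, t)` lies in
`(s_i, t)`; sphere `i` flies freely on `(s_i, t)`, so at time `u` its position is `x_i(s_i) + proj((u − s_i) v_i)`, within
`r` of `anchorPt = centre(cell of x_i(s_i)) + proj((u − s_i) v_i)`, and its velocity is the photo velocity `v_i`.
[folklore] -/
theorem flow_gridTime_anchorPt : ∀ (σ : ℝ) (N : ℕ) (Φ : Flow σ N) (r A : ℝ), 0 < σ → 0 < r → 0 < A →
    ∀ z : Phase N, z ∈ Φ.good → ∀ (i : Fin (N + 1)) (n : ℕ), 0 ≤ Φ.nthCollisionTimeOf i n z →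
    IsLong A (tN N) (past Φ r z i n) →
    flightStart (Torus.geometry (Fin 3)) (hsDiameter σ N) (fun s => Φ.flow s z) 0 i (Φ.nthCollisionTimeOf i n z) <
        gridTime A (tN N) (Φ.nthCollisionTimeOf i n z) ∧
      gridTime A (tN N) (Φ.nthCollisionTimeOf i n z) < Φ.nthCollisionTimeOf i n z ∧
      Torus.euclidDist ((Φ.flow (gridTime A (tN N) (Φ.nthCollisionTimeOf i n z)) z) i).1
          (anchorPt r A (tN N) (past Φ r z i n) i) ≤ r ∧
      ((Φ.flow (gridTime A (tN N) (Φ.nthCollisionTimeOf i n z)) z) i).2 = ((past Φ r z i n).1.1.1 i).2 := by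
  intro σ N Φ r A _ hr hA z hz i n ht hL
  simp only [IsLong, anchorPt, past, if_pos hz, HardSphereFlow.coarsePastOf, coarseConfig_apply] at hL ⊢
  have hm : 0 < gridMesh A (tN N) := gridMesh_pos hA (tN_pos N)
  have hg := gridTime_mem A (tN N) (Φ.nthCollisionTimeOf i n z) hA (tN_pos N)
  rw [div_eq_two_mul_gridMesh hA] at hL
  have hsu : flightStart (Torus.geometry (Fin 3)) (hsDiameter σ N) (fun s => Φ.flow s z) 0 i
      (Φ.nthCollisionTimeOf i n z) < gridTime A (tN N) (Φ.nthCollisionTimeOf i n z) := by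
    linarith [hg.1]
  refine ⟨hsu, hg.2, ?_, flow_vel_eq_of_mem_Ico_flightStart hz i ⟨hsu.le, hg.2⟩⟩
  rw [flow_pos_eq_of_mem_Icc_flightStart hz i ht ⟨hsu.le, hg.2.le⟩, torus_euclidDist_add_right]
  exact euclidDist_cellCentre_coarseCell_le hr _

end Summit.AtomisticToContinuum.HydrodynamicLimit.Theorems.KickFairRelEquilibriumMesoLine

end
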